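import Summits.Schanuel.Schanuel.Theorems.RootDecomp1BTameFlagSteps
import Summits.Schanuel.Schanuel.Theorems.RootDecomp1BFedFlag

/-!
# RootDecomp1B — round 8 (lens-4 gen 8 «PolarWildFlag»): the fed flag widened to the TAME flag, the residual cut to WILD ABSORBING tuples

Port target: `lean/Summits/Schanuel/Schanuel/Theorems/RootDecomp1BTameFlag.lean`
(`--supports stmt-Schanuel-31200`; evidence for the asides of 31200 / 31201 / 25469 / 30166).

Over the LIVE route constants of `Theses/RootDecomp1B.lean` (rev ≥ 18: `FedSharpStep` 31200, `FedSurplusOneStep` 31201,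
`NoDefectTwoFirstFailure` 25469, `NoAutonomousSlackFirstFailure` 30166, `BaseFedCoupling` 30165, `LocalSurplusBudget` 27214,
`FreeSideCoupling` 28104, `TightBudgetCoupling` 29188, `KleinPolarSchanuel` 24622) and the Theses-independent kernel
`Theorems/RootDecomp1BTameFlagCore.lean` (local statements `TameSharpStep`, `TameSurplusOneStep`, `WildSharpHyperplane`,
`NoWildAbsorbingSlackFirstFailure`):

* `fedSharpStep_of_tameSharpStep`, `fedSurplusOneStep_of_tameSurplusOneStep` — the gen-7 flag steps follow from the gen-8 TAME steps (landed in `Theorems.RootDecomp1BTameFlagSteps`, namespace `…TameFlagCore`; not restated here);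
* `noDefectTwoFirstFailure_of_pieces8 : TSH → TS1 → WSH → NoDefectTwoFirstFailure` — C₁′ (25469) follows;
* `noAutonomousSlackFirstFailure_of_pieces8 : TSH → TS1 → WSH → WAS → NoAutonomousSlackFirstFailure` — the round-6 residual (30166) follows;
* `baseFedCoupling_of_tame_steps` (30165, already aside);
* `kleinPolarSchanuel_of_pieces8 : LSB → Free → Tight → TSH → TS1 → WSH → WAS → KleinPolarSchanuel` — the whole chain beneath the EQUIV layer.

This file defines nothing; no transcendence input; 0 sorry.
-/

set_option linter.dupNamespace false

namespace Summit.Schanuel.Schanuel.Theorems.RootDecomp1BTameFlag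

open Summit.Schanuel.Schanuel.Theses.RootDecomp1B (KleinPolarSchanuel LocalSurplusBudget FreeSideCoupling TightBudgetCoupling
  NoDefectTwoFirstFailure FedSharpStep FedSurplusOneStep BaseFedCoupling NoAutonomousSlackFirstFailure)
open Summit.Schanuel.Schanuel.Theorems.RootDecomp1BTameFlagCore (TameSharpStep TameSurplusOneStep WildSharpHyperplane
  NoWildAbsorbingSlackFirstFailure tameKleinPolar_of_flag_steps wild_dichotomy isTame_or_isWild fedKleinPolar_of_tameKleinPolar)
open Summit.Schanuel.Schanuel.Theorems.RootDecomp1BFedFlagCore (polarDeg)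

-- The retirements of FSH (stmt-Schanuel-31200) and FS1 (stmt-Schanuel-31201) — `fedSharpStep_of_tameSharpStep`,
-- `fedSurplusOneStep_of_tameSurplusOneStep` — are ALREADY LANDED verbatim (same statements over the route decls) in
-- `Theorems/RootDecomp1BTameFlagSteps.lean` (namespace `…Theorems.RootDecomp1BTameFlagCore`); they are not restated here.

/-- retires C₁′ (stmt-Schanuel-25469): `TSH → TS1 → WSH → NoDefectTwoFirstFailure` — tame tuples get `2m` from the tame flag, wild
tuples get `2m − 1` (absorbing, monotonicity) or `2m` (sharp hyperplane); the side hypotheses `m ≤ a`, `m ≤ b` are not even used. -/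
theorem noDefectTwoFirstFailure_of_pieces8 (hTS : TameSharpStep) (hT1 : TameSurplusOneStep) (hWSH : WildSharpHyperplane) :
    NoDefectTwoFirstFailure := by
  intro m r hr hIH _ _
  show ((m + m - 1 : ℕ) : Cardinal) ≤ polarDeg r
  have hle : ((m + m - 1 : ℕ) : Cardinal) ≤ ((m + m : ℕ) : Cardinal) := by exact_mod_cast Nat.sub_le _ _
  rcases isTame_or_isWild r with hT | hW
  · exact hle.trans (tameKleinPolar_of_flag_steps hTS hT1 m r hr hIH hT)
  · rcases wild_dichotomy hWSH hr hIH hW with ⟨_, hlow⟩ | hdone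
    · exact hlow
    · exact hle.trans hdone

/-- retires Aut (stmt-Schanuel-30166): `TSH → TS1 → WSH → WAS → NoAutonomousSlackFirstFailure` (the autonomy hypothesis is not used:
tame | wild is decided by the pair degree, and the wild absorbing slack case is exactly the new residual). -/
theorem noAutonomousSlackFirstFailure_of_pieces8 (hTS : TameSharpStep) (hT1 : TameSurplusOneStep)
    (hWSH : WildSharpHyperplane) (hR : NoWildAbsorbingSlackFirstFailure) : NoAutonomousSlackFirstFailure := by
  intro m r hr hIH hB ha hb hσ _ hT
  show ((m + m : ℕ) : Cardinal) ≤ polarDeg r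
  rcases isTame_or_isWild r with hTm | hW
  · exact tameKleinPolar_of_flag_steps hTS hT1 m r hr hIH hTm
  · rcases wild_dichotomy hWSH hr hIH hW with ⟨hA, _⟩ | hdone
    · exact hR m r hr hIH hB ha hb hσ hW hA hT
    · exact hdone

/-- the banked round-6 parent BaseFedCoupling (stmt-Schanuel-30165) from the tame steps (via `FedKleinPolar`). -/
theorem baseFedCoupling_of_tame_steps (hS : TameSharpStep) (h1 : TameSurplusOneStep) : BaseFedCoupling :=
  RootDecomp1BFedFlag.baseFedCoupling_of_fedKleinPolar (fedKleinPolar_of_tameKleinPolar (tameKleinPolar_of_flag_steps hS h1))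

/-- beneath the EQUIV layer: `LSB → Free → Tight → TSH → TS1 → WSH → WAS → KleinPolarSchanuel`, by strong induction on the length —
TAME tuples by the tame flag, WILD tuples with a sharp hyperplane by WSH, wild ABSORBING tuples (`t ≥ 2m − 1` for free) by the
budget / free-side / hypotenuse analysis of rounds 3–5 with the residual in the slack case (this is the route glue's `hX`). -/
theorem kleinPolarSchanuel_of_pieces8 (hLSB : LocalSurplusBudget) (hFree : FreeSideCoupling) (hTight : TightBudgetCoupling)
    (hTS : TameSharpStep) (hT1 : TameSurplusOneStep) (hWSH : WildSharpHyperplane) (hR : NoWildAbsorbingSlackFirstFailure) :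
    KleinPolarSchanuel := by
  intro m
  induction m using Nat.strong_induction_on with
  | h m ih =>
    intro r hr
    rcases isTame_or_isWild r with hT | hW
    · exact tameKleinPolar_of_flag_steps hTS hT1 m r hr ih hT
    · rcases wild_dichotomy hWSH hr ih hW with ⟨hA, hlow⟩ | hdone
      · have hB := hLSB m r hr ih
        refine (Classical.em _).elim (fun h => hFree m r hr ih hB h hlow) (fun h => ?_)
        have ha' := Cardinal.add_one_le_of_lt (not_le.mp (not_or.mp h).1)
        have hb' := Cardinal.add_one_le_of_lt (not_le.mp (not_or.mp h).2)
        refine (le_or_gt _ _).elim (fun hσ => hTight m r hr ih hB ha' hb' hσ hlow) (fun hσ => ?_)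
        exact hR m r hr ih hB ha' hb' (Cardinal.add_one_le_of_lt hσ) hW hA hlow
      · exact hdone

/-- **GLUE item stmt-Schanuel-32145** (route-Schanuel-RootDecomp1B round 8 «PolarWildFlag», remedy R3 «S8-N», critic
2026-08-30T10:25:06Z; typed by writer-1 10:46:40Z): the four round-8 children imply the round-7 residual,
`TameSharpStep → TameSurplusOneStep → WildSharpHyperplane → NoWildAbsorbingSlackFirstFailure → NoAutonomousSlackFirstFailure`,
LITERALLY the route decl `RootDecomp1B.NoAutonomousSlackFirstFailureGlue` (the `Theorems.RootDecomp1BTameFlagCore` copies of the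
four pieces are the same terms as the route decls, so `noAutonomousSlackFirstFailure_of_pieces8` closes it by unfolding). -/
theorem noAutonomousSlackFirstFailureGlue_holds :
    Summit.Schanuel.Schanuel.Theses.RootDecomp1B.NoAutonomousSlackFirstFailureGlue := by
  unfold Summit.Schanuel.Schanuel.Theses.RootDecomp1B.NoAutonomousSlackFirstFailureGlue
  intro hTS hT1 hWSH hR
  exact noAutonomousSlackFirstFailure_of_pieces8 hTS hT1 hWSH hR

end Summit.Schanuel.Schanuel.Theorems.RootDecomp1BTameFlag
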